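import Summits.ValiantsHypothesis.ValiantsHypothesis.Theorems.LacunarySymmetroidMatrixDescartesCensusDoorA34IsotropicCoreWindow

/-!
# `MatrixDescartes` census — DOOR A at `(3,4)`: bricks of the «PEELING» route to the 2 × 2 ORIENTATION LAW — generalized Vandermonde NON-VANISHING in every
# size, the RAY-SIGN lemma, and the PADDED FIVE-NOMIAL (degenerate Gram ⇒ at most three positive roots)

HONEST FRAMING.  Object-search cell `pub-symmetroid`, engine seat `val-sym-eng-2` (g10); helper row beside the registered strata line
`Cruxes/DoorA34/Lines/strata.lean` on stmt-ValiantsHypothesis-19980 (`DoorA34 = PosRootLawAt 3 4 18`: OPEN, typed, never asserted here), continuing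
…CensusDoorA34SheetWindowGram (realisability square, Gram form, degenerate Gram ⇒ ≤ 4 roots, bracket positivity).  The seat's located ★ ORIENTATION LAW
(report HOME/DOOR-A34-ENG2G10-REPORT.md §6(c): a real symmetric 2 × 2 window pencil with five positive det-roots is definite beyond its last root) still lacks,
in the kernel, the SIGN of the Gram determinant of a five-root six-nomial.  Report §6(h) lays out an elementary «peeling» route (top-root asymptotics, level by
level); THIS FILE lands three of its bricks, all [folklore]:

* `genVandermonde_det_ne_zero` — for pairwise distinct positive nodes and pairwise distinct natural exponents, `det[rᵢ^{eⱼ}] ≠ 0` in EVERY size (a kernel vector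
  would be a `k`-nomial with `k` positive roots, against Descartes' bound `card_roots_toFinset_filter_pos_lt_card_support`);
* `leadingCoeff_mul_eval_pos_of_no_roots_beyond` — RAY-SIGN: a real polynomial of positive degree without zeros beyond `a` has, beyond `a`, the sign of its
  leading coefficient (eventual sign + intermediate value theorem);
* **`card_posRoots_le_three_of_padded_gram_det_eq_zero`** — the PADDED five-nomial `c₀ + c₁x^{d₁} + c₂x^{2d₁} + c₃x^{d₂} + c₄x^{d₁+d₂}` with SINGULAR padded Gram
  `[[c₀, c₁/2, c₃/2], [c₁/2, c₂, c₄/2], [c₃/2, c₄/2, 0]]` has, if non-zero, at most THREE positive roots (the vanishing corner makes one factor of the binary-form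
  representation a binomial) — so a FOUR-root five-nomial on `{0, d₁, 2d₁, d₂, d₁+d₂}` has `c₁c₃c₄ − c₀c₄² − c₂c₃² ≠ 0`, the non-vanishing the peeling step
  `5 → 4` needs.

Nothing here is located; nothing bounds the sheet; `DoorA34` and the three stubs stay OPEN; registers unchanged (`ζ_sym(3,4) ∈ {18,19}`); nothing on
`MatrixDescartes` (stmt-ValiantsHypothesis-18050) or on `VP ≠ VNP` — VP≠VNP not moved.
-/

-- `Summit.ValiantsHypothesis.ValiantsHypothesis.…` repeats a component by the D-0017 layout
-- (single-conjunct summit), which the `dupNamespace` linter flags; the name is mandated.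
set_option linter.dupNamespace false

namespace Summit.ValiantsHypothesis.ValiantsHypothesis.Theorems.LacunarySymmetroidMatrixDescartes.Census

open scoped BigOperators Matrix
open Polynomial Finset

/-! ## 1. Generalized Vandermonde non-vanishing (every size) and the ray-sign lemma -/

/-- **GENERALIZED VANDERMONDE NON-VANISHING (any size)**: for pairwise distinct positive nodes `r : Fin k → ℝ` and pairwise distinct exponents `e : Fin k → ℕ`,
`det[r i ^ e j] ≠ 0` — a kernel vector would be a `k`-nomial with `k` positive roots, against Descartes. [folklore] -/
theorem genVandermonde_det_ne_zero {k : ℕ} (r : Fin k → ℝ) (e : Fin k → ℕ) (hr : Function.Injective r) (hpos : ∀ i, 0 < r i)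
    (he : Function.Injective e) :
    (Matrix.of fun i j : Fin k => r i ^ e j).det ≠ 0 := by
  classical
  intro hdet
  obtain ⟨a, ha, hMa⟩ := Matrix.exists_mulVec_eq_zero_iff.2 hdet
  -- the k-nomial P = Σ_j a_j X^{e_j}
  set P : ℝ[X] := ∑ j, C (a j) * X ^ e j with hP
  have hcoeff : ∀ j, P.coeff (e j) = a j := by
    intro j
    rw [hP, finsetSum_coeff]
    rw [Finset.sum_eq_single j]
    · rw [coeff_C_mul, coeff_X_pow, if_pos rfl, mul_one]
    · intro j' _ hj'
      rw [coeff_C_mul, coeff_X_pow, if_neg (fun h => hj' (he h).symm), mul_zero]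
    · intro h; exact absurd (Finset.mem_univ j) h
  have hPne : P ≠ 0 := by
    obtain ⟨j, hj⟩ := Function.ne_iff.1 ha
    intro h0
    apply hj
    rw [← hcoeff j, h0, coeff_zero]; rfl
  -- every node is a root of P
  have hroot : ∀ i, P.eval (r i) = 0 := by
    intro i
    have := congrFun hMa i
    simp only [Matrix.mulVec, dotProduct, Matrix.of_apply, Pi.zero_apply] at this
    rw [hP, eval_finsetSum]
    simp only [eval_mul, eval_C, eval_pow, eval_X]
    rw [← this]
    exact Finset.sum_congr rfl fun j _ => mul_comm _ _
  -- support of P ⊆ image of e (card ≤ k), positive roots ⊇ image of r (card = k): Descartes' strict inequality is violated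
  have hsupp : P.support ⊆ Finset.univ.image e := by
    intro m hm
    rw [mem_support_iff, hP, finsetSum_coeff] at hm
    by_contra hnot
    apply hm
    refine Finset.sum_eq_zero fun j _ => ?_
    rw [coeff_C_mul, coeff_X_pow, if_neg, mul_zero]
    intro hmj; exact hnot (Finset.mem_image.2 ⟨j, Finset.mem_univ _, hmj.symm⟩)
  have hroots : Finset.univ.image r ⊆ P.roots.toFinset.filter (fun t => 0 < t) := by
    intro t ht
    obtain ⟨i, _, rfl⟩ := Finset.mem_image.1 ht
    rw [Finset.mem_filter, Multiset.mem_toFinset, mem_roots hPne, IsRoot.def]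
    exact ⟨hroot i, hpos i⟩
  have h1 := Finset.card_le_card hroots
  have h2 := Literature.Computability.AlgebraicComplexity.card_roots_toFinset_filter_pos_lt_card_support hPne
  have h3 := Finset.card_le_card hsupp
  rw [Finset.card_image_of_injective _ hr, Finset.card_univ, Fintype.card_fin] at h1
  have h4 : (Finset.univ.image e).card ≤ k := Finset.card_image_le.trans (by rw [Finset.card_univ, Fintype.card_fin])
  omega

/-- **RAY-SIGN LEMMA**: a real polynomial of positive degree with no zero beyond `a` has, beyond `a`, the sign of its leading coefficient. [folklore] -/
theorem leadingCoeff_mul_eval_pos_of_no_roots_beyond (P : ℝ[X]) (hdeg : 0 < P.degree) (a : ℝ) (hno : ∀ z, a < z → P.eval z ≠ 0)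
    (x : ℝ) (hx : a < x) : 0 < P.leadingCoeff * P.eval x := by
  have hP : P ≠ 0 := by rintro rfl; simp at hdeg
  -- reduce to a positive leading coefficient by replacing P with −P
  suffices key : ∀ R : ℝ[X], 0 < R.degree → 0 < R.leadingCoeff → (∀ z, a < z → R.eval z ≠ 0) → 0 < R.eval x by
    rcases lt_or_gt_of_ne (leadingCoeff_ne_zero.2 hP) with hneg | hposlc
    · have hnegP : 0 < (-P).leadingCoeff := by rw [leadingCoeff_neg]; linarith
      have hdeg' : 0 < (-P).degree := by rwa [degree_neg]
      have := key (-P) hdeg' hnegP (fun z hz => by rw [eval_neg, neg_ne_zero]; exact hno z hz)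
      rw [eval_neg] at this
      nlinarith
    · exact mul_pos hposlc (key P hdeg hposlc hno)
  intro R hRdeg hRlc hRno
  refine lt_of_not_ge fun hle => ?_
  have hlt : R.eval x < 0 := lt_of_le_of_ne hle (hRno x hx)
  have htend := Polynomial.tendsto_atTop_of_leadingCoeff_nonneg R hRdeg hRlc.le
  obtain ⟨y, hy⟩ := ((htend.eventually (Filter.eventually_gt_atTop 0)).and (Filter.eventually_gt_atTop x)).exists
  obtain ⟨z, hz, hRz⟩ := intermediate_value_Icc hy.2.le (R.continuous.continuousOn) ⟨hlt.le, hy.1.le⟩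
  have hxz : x < z := by
    rcases eq_or_lt_of_le hz.1 with h | h
    · rw [← h] at hRz; exact absurd hRz hlt.ne
    · exact h
  exact hRno z (hx.trans hxz) hRz

/-! ## 2. The padded five-nomial: degenerate Gram ⇒ at most THREE positive roots (the `E₄ ≠ 0` brick of the peeling route) -/

/-- Descartes for binomials: at most two monomials ⇒ at most one positive root. [folklore] -/
private theorem card_posRoots_le_one_of_binomial (k m : ℕ) (a b : ℝ) (h : C a * X ^ k + C b * X ^ m ≠ (0 : ℝ[X])) :
    ((C a * X ^ k + C b * X ^ m).roots.toFinset.filter (fun t => 0 < t)).card ≤ 1 := by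
  classical
  have h1 := Literature.Computability.AlgebraicComplexity.card_roots_toFinset_filter_pos_lt_card_support h
  have h2 : (C a * X ^ k + C b * X ^ m).support.card ≤ 2 := (Finset.card_le_card (support_binomial_subset k m a b)).trans Finset.card_le_two
  omega

/-- If a non-zero constant multiple of `g` is a binomial times a trinomial (on `{0, d₁, d₂}`), then `g` has at most three positive roots. [folklore] -/
private theorem card_posRoots_le_three_of_eq_binomial_mul_trinomial (g : ℝ[X]) (κ : ℝ) (hκ : κ ≠ 0) (k m d₁ d₂ : ℕ) (a b u v w : ℝ)
    (h : C κ * g = (C a * X ^ k + C b * X ^ m) * (C u * X ^ 0 + C v * X ^ d₁ + C w * X ^ d₂)) (hg : g ≠ 0) :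
    (g.roots.toFinset.filter (fun t => 0 < t)).card ≤ 3 := by
  classical
  have hκg : C κ * g ≠ 0 := mul_ne_zero (by rwa [Ne, C_eq_zero]) hg
  rw [← roots_C_mul g hκ, h]
  rw [h] at hκg
  refine (card_posRoots_mul_le _ _ hκg).trans ?_
  have hB := card_posRoots_le_one_of_binomial k m a b (left_ne_zero_of_mul hκg)
  have hT := card_posRoots_le_two_of_support_subset_three _ (right_ne_zero_of_mul hκg) (support_trinomial_subset 0 d₁ d₂ u v w)
  omega

/-- **PADDED FIVE-NOMIAL: DEGENERATE GRAM ⇒ AT MOST THREE POSITIVE ROOTS.**  Let `g = c₀ + c₁x^{d₁} + c₂x^{2d₁} + c₃x^{d₂} + c₄x^{d₁+d₂}` (the six-nomial with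
`c₅ = 0`) and let the padded Gram matrix `[[c₀, c₁/2, c₃/2], [c₁/2, c₂, c₄/2], [c₃/2, c₄/2, 0]]` be singular.  Then `g`, if non-zero, has at most `3` distinct positive
roots: in the binary-form representation (…SheetWindowGram §5) the vanishing corner makes one factor a BINOMIAL.  Contrapositive (the `E₄ ≠ 0` step of the peeling route, report §6(h)):
a FOUR-root five-nomial on `{0, d₁, 2d₁, d₂, d₁+d₂}` has `c₁c₃c₄ − c₀c₄² − c₂c₃² = 4·det ≠ 0`. [folklore] -/
theorem card_posRoots_le_three_of_padded_gram_det_eq_zero (d₁ d₂ : ℕ) (c₀ c₁ c₂ c₃ c₄ : ℝ)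
    (hQ : (!![c₀, c₁ / 2, c₃ / 2; c₁ / 2, c₂, c₄ / 2; c₃ / 2, c₄ / 2, 0] : Matrix (Fin 3) (Fin 3) ℝ).det = 0)
    (hg : C c₀ * X ^ 0 + C c₁ * X ^ d₁ + C c₂ * X ^ (2 * d₁) + C c₃ * X ^ d₂ + C c₄ * X ^ (d₁ + d₂) ≠ (0 : ℝ[X])) :
    ((C c₀ * X ^ 0 + C c₁ * X ^ d₁ + C c₂ * X ^ (2 * d₁) + C c₃ * X ^ d₂ + C c₄ * X ^ (d₁ + d₂)).roots.toFinset.filter (fun t => 0 < t)).card ≤ 3 := by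
  classical
  obtain ⟨n, hn, hk⟩ := Matrix.exists_mulVec_eq_zero_iff.2 hQ
  have hvec : n = ![n 0, n 1, n 2] := by ext i; fin_cases i <;> rfl
  have e0 := congrFun hk 0; have e1 := congrFun hk 1; have e2 := congrFun hk 2
  rw [hvec] at e0 e1 e2
  simp only [Matrix.mulVec, dotProduct, Fin.sum_univ_three, Matrix.of_apply, Matrix.cons_val', Matrix.cons_val_zero, Matrix.cons_val_one,
    Matrix.cons_val_two, Matrix.empty_val', Matrix.cons_val_fin_one, Matrix.head_cons, Matrix.tail_cons, Matrix.head_fin_const,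
    Pi.zero_apply, zero_mul, add_zero] at e0 e1 e2
  set g : ℝ[X] := C c₀ * X ^ 0 + C c₁ * X ^ d₁ + C c₂ * X ^ (2 * d₁) + C c₃ * X ^ d₂ + C c₄ * X ^ (d₁ + d₂) with hgdef
  by_cases h2 : n 2 ≠ 0
  · -- kernel (ρ₀, ρ₁, 1): c₃, c₄ in terms of c₀, c₁, c₂ and the corner equation q(ρ₀, ρ₁) = 0
    set ρ₀ := n 0 / n 2 with hρ₀
    set ρ₁ := n 1 / n 2 with hρ₁
    have k0 : c₀ * ρ₀ + c₁ / 2 * ρ₁ + c₃ / 2 = 0 := by rw [hρ₀, hρ₁]; field_simp; linarith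
    have k1 : c₁ / 2 * ρ₀ + c₂ * ρ₁ + c₄ / 2 = 0 := by rw [hρ₀, hρ₁]; field_simp; linarith
    have k2 : c₃ / 2 * ρ₀ + c₄ / 2 * ρ₁ = 0 := by rw [hρ₀, hρ₁]; field_simp; linarith
    have e3 : c₃ = -(2 * c₀ * ρ₀ + c₁ * ρ₁) := by linarith
    have e4 : c₄ = -(c₁ * ρ₀ + 2 * c₂ * ρ₁) := by linarith
    have hq : c₀ * ρ₀ ^ 2 + c₁ * ρ₀ * ρ₁ + c₂ * ρ₁ ^ 2 = 0 := by linear_combination (ρ₀ / 2) * e3 + (ρ₁ / 2) * e4 - k2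
    by_cases hρ₁ : ρ₁ ≠ 0
    · refine card_posRoots_le_three_of_eq_binomial_mul_trinomial g (ρ₁ ^ 2) (pow_ne_zero 2 hρ₁) 0 d₁ d₁ d₂ ρ₁ (-ρ₀)
        (c₀ * ρ₁) (c₀ * ρ₀ + c₁ * ρ₁) (c₃ * ρ₁) ?_ hg
      have hqC : C c₀ * C ρ₀ ^ 2 + C c₁ * C ρ₀ * C ρ₁ + C c₂ * C ρ₁ ^ 2 = (0 : ℝ[X]) := by
        have := congrArg C hq; simpa only [map_mul, map_pow, map_add, map_zero] using this
      have hk2C : C c₃ * C ρ₀ + C c₄ * C ρ₁ = (0 : ℝ[X]) := by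
        have h' : c₃ * ρ₀ + c₄ * ρ₁ = 0 := by linarith
        have := congrArg C h'; simpa only [map_mul, map_add, map_zero] using this
      rw [hgdef]
      simp only [map_neg, map_add, map_mul, map_pow]
      linear_combination (X ^ (2 * d₁)) * hqC + (C ρ₁ * X ^ (d₁ + d₂)) * hk2C
    · by_cases hρ₀ : ρ₀ ≠ 0
      · -- here ρ₁ = 0: hq gives c₀ = 0, then c₃ = 0, and g = x^{d₁}·(c₁ + c₂x^{d₁} + c₄x^{d₂})
        rw [not_ne_iff] at hρ₁
        have hc0 : c₀ = 0 := by
          have : c₀ * ρ₀ ^ 2 = 0 := by rw [hρ₁] at hq; linarith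
          rcases mul_eq_zero.1 this with h | h
          · exact h
          · exact absurd (pow_eq_zero_iff (n := 2) (by norm_num) |>.1 h) hρ₀
        have hc3 : c₃ = 0 := by rw [e3, hc0, hρ₁]; ring
        refine card_posRoots_le_three_of_eq_binomial_mul_trinomial g 1 one_ne_zero 0 d₁ d₁ d₂ 0 1 c₁ c₂ c₄ ?_ hg
        rw [hgdef, hc0, hc3]
        simp only [map_zero, map_one, zero_mul, zero_add, one_mul, add_zero]
        ring
      · rw [not_ne_iff] at hρ₀ hρ₁
        have hc3 : c₃ = 0 := by rw [e3, hρ₀, hρ₁]; ring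
        have hc4 : c₄ = 0 := by rw [e4, hρ₀, hρ₁]; ring
        have hgt : g = C c₀ * X ^ 0 + C c₁ * X ^ d₁ + C c₂ * X ^ (2 * d₁) := by
          rw [hgdef, hc3, hc4]; simp only [map_zero, zero_mul, add_zero]
        rw [hgt] at hg ⊢
        exact (card_posRoots_le_two_of_support_subset_three _ hg (support_trinomial_subset _ _ _ _ _ _)).trans (by norm_num)
  rw [not_ne_iff] at h2
  simp only [h2, mul_zero, add_zero] at e0 e1
  by_cases h1 : n 1 ≠ 0
  · -- kernel (ρ₀, 1, 0): c₁ = −2c₀ρ₀, c₂ = c₀ρ₀², c₄ = −c₃ρ₀ ⇒ g = (1 − ρ₀x^{d₁})·(c₀ − c₀ρ₀ x^{d₁} + c₃ x^{d₂})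
    set ρ₀ := n 0 / n 1 with hρ₀
    have k0 : c₀ * ρ₀ + c₁ / 2 = 0 := by rw [hρ₀]; field_simp; linarith
    have k1 : c₁ / 2 * ρ₀ + c₂ = 0 := by rw [hρ₀]; field_simp; linarith
    have k2 : c₃ / 2 * ρ₀ + c₄ / 2 = 0 := by rw [hρ₀]; field_simp; linarith
    have e1' : c₁ = -(2 * c₀ * ρ₀) := by linarith
    have e2' : c₂ = c₀ * ρ₀ ^ 2 := by linear_combination k1 - ρ₀ * k0
    have e4' : c₄ = -(c₃ * ρ₀) := by linarith
    refine card_posRoots_le_three_of_eq_binomial_mul_trinomial g 1 one_ne_zero 0 d₁ d₁ d₂ 1 (-ρ₀) c₀ (-(c₀ * ρ₀)) c₃ ?_ hg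
    rw [hgdef, e1', e2', e4']
    simp only [map_neg, map_mul, map_pow, map_one, map_ofNat, one_mul]
    ring
  rw [not_ne_iff] at h1
  simp only [h1, mul_zero, add_zero] at e0 e1 e2
  have h0 : n 0 ≠ 0 := by
    intro h; apply hn; rw [hvec]; ext i; fin_cases i <;> simp [h, h1, h2]
  -- kernel (1, 0, 0): c₀ = c₁ = c₃ = 0 ⇒ g is a binomial
  have hc0 : c₀ = 0 := by
    have : c₀ * n 0 = 0 := by linarith
    exact (mul_eq_zero.1 this).resolve_right h0
  have hc1 : c₁ = 0 := by
    have : c₁ / 2 * n 0 = 0 := by linarith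
    have := (mul_eq_zero.1 this).resolve_right h0; linarith
  have hc3 : c₃ = 0 := by
    have : c₃ / 2 * n 0 = 0 := by linarith
    have := (mul_eq_zero.1 this).resolve_right h0; linarith
  have hgt : g = C c₂ * X ^ (2 * d₁) + C c₄ * X ^ (d₁ + d₂) := by
    rw [hgdef, hc0, hc1, hc3]; simp only [map_zero, zero_mul, zero_add, add_zero]
  rw [hgt] at hg ⊢
  exact (card_posRoots_le_one_of_binomial _ _ _ _ hg).trans (by norm_num)

/-! ## 3. Generalized Vandermonde POSITIVITY in every size (total positivity of `x^a`, natural exponents) -/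

/-- Laplace expansion of the generalized Vandermonde along its LAST row, packaged as a polynomial in the last node. [folklore] -/
theorem genVandermonde_det_eq_eval {k : ℕ} (r : Fin (k + 1) → ℝ) (e : Fin (k + 2) → ℕ) (y : ℝ) :
    (Matrix.of fun i j : Fin (k + 2) => (Fin.snoc r y : Fin (k + 2) → ℝ) i ^ e j).det
      = (∑ j : Fin (k + 2), C ((-1) ^ ((k + 1) + (j : ℕ)) *
          (Matrix.of fun i l : Fin (k + 1) => r i ^ e (j.succAbove l)).det) * X ^ e j).eval y := by
  rw [Matrix.det_succ_row _ (Fin.last (k + 1)), eval_finsetSum]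
  refine Finset.sum_congr rfl fun j _ => ?_
  rw [eval_mul, eval_C, eval_pow, eval_X]
  simp only [Matrix.of_apply, Fin.snoc_last, Fin.val_last]
  have hsub : (Matrix.of fun i j' : Fin (k + 2) => (Fin.snoc r y : Fin (k + 2) → ℝ) i ^ e j').submatrix (Fin.last (k + 1)).succAbove j.succAbove
      = Matrix.of fun i l : Fin (k + 1) => r i ^ e (j.succAbove l) := by
    ext i l
    simp only [Matrix.submatrix_apply, Matrix.of_apply, Fin.succAbove_last, Fin.snoc_castSucc]
  rw [hsub]; ring

/-- **GENERALIZED VANDERMONDE POSITIVITY (every size)**: strictly increasing positive nodes and strictly increasing natural exponents ⇒ `det[rᵢ^{eⱼ}] > 0`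
— total positivity of the monomial kernel; induction on the size: expand along the last row, the top cofactor is positive by induction, the polynomial in the last
node has no zero beyond the previous node (`genVandermonde_det_ne_zero`), so the RAY-SIGN lemma gives the sign.  In particular ALL the minors `D_j` of the
five-root interpolant and all ten brackets of report §6(b) are positive. [folklore] -/
theorem genVandermonde_det_pos : ∀ (k : ℕ) (r : Fin (k + 1) → ℝ) (e : Fin (k + 1) → ℕ),
    StrictMono r → 0 < r 0 → StrictMono e → 0 < (Matrix.of fun i j : Fin (k + 1) => r i ^ e j).det := by
  intro k
  induction k with
  | zero =>
    intro r e _ h0 _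
    rw [Matrix.det_fin_one, Matrix.of_apply]
    exact pow_pos h0 _
  | succ k ih =>
    intro r e hr h0 he
    classical
    -- nodes r₀ < … < r_{k+1}; split off the last one
    set r' : Fin (k + 1) → ℝ := fun i => r (Fin.castSucc i) with hr'
    have hsnoc : (Fin.snoc r' (r (Fin.last (k + 1))) : Fin (k + 2) → ℝ) = r := by
      ext i
      refine Fin.lastCases ?_ (fun i => ?_) i
      · simp only [Fin.snoc_last]
      · simp only [Fin.snoc_castSucc, hr']
    -- the cofactor polynomial in the last node
    set a : Fin (k + 2) → ℝ := fun j => (-1) ^ ((k + 1) + (j : ℕ)) * (Matrix.of fun i l : Fin (k + 1) => r' i ^ e (j.succAbove l)).det with ha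
    set P : ℝ[X] := ∑ j : Fin (k + 2), C (a j) * X ^ e j with hP
    have hPeval : ∀ y, (Matrix.of fun i j : Fin (k + 2) => (Fin.snoc r' y : Fin (k + 2) → ℝ) i ^ e j).det = P.eval y := fun y =>
      genVandermonde_det_eq_eval r' e y
    -- the top cofactor is a positive generalized Vandermonde (induction hypothesis)
    have hr'mono : StrictMono r' := fun i j hij => hr (Fin.castSucc_lt_castSucc_iff.2 hij)
    have htop : 0 < a (Fin.last (k + 1)) := by
      rw [ha]
      simp only [Fin.val_last, Fin.succAbove_last]
      rw [show k + 1 + (k + 1) = 2 * (k + 1) by ring, pow_mul, neg_one_sq, one_pow, one_mul]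
      exact ih r' (fun l => e (Fin.castSucc l)) hr'mono h0 (fun i j hij => he (Fin.castSucc_lt_castSucc_iff.2 hij))
    -- degree and leading coefficient of P: the last term dominates
    have hsplit : P = (∑ j : Fin (k + 1), C (a (Fin.castSucc j)) * X ^ e (Fin.castSucc j)) + C (a (Fin.last (k + 1))) * X ^ e (Fin.last (k + 1)) := by
      rw [hP, Fin.sum_univ_castSucc]
    have hdeg_top : (C (a (Fin.last (k + 1))) * X ^ e (Fin.last (k + 1))).degree = (e (Fin.last (k + 1)) : WithBot ℕ) :=
      degree_C_mul_X_pow _ htop.ne'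
    have hdeg_rest : (∑ j : Fin (k + 1), C (a (Fin.castSucc j)) * X ^ e (Fin.castSucc j)).degree < (e (Fin.last (k + 1)) : WithBot ℕ) := by
      refine (degree_sum_le _ _).trans_lt ?_
      refine (Finset.sup_lt_iff (WithBot.bot_lt_coe _)).2 fun j _ => ?_
      refine (degree_C_mul_X_pow_le _ _).trans_lt ?_
      exact_mod_cast he (Fin.castSucc_lt_last j)
    have hlc : P.leadingCoeff = a (Fin.last (k + 1)) := by
      rw [hsplit, leadingCoeff_add_of_degree_lt (hdeg_rest.trans_le hdeg_top.ge), leadingCoeff_C_mul_X_pow]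
    have hdegP : P.degree = (e (Fin.last (k + 1)) : WithBot ℕ) := by
      rw [hsplit, degree_add_eq_right_of_degree_lt (hdeg_rest.trans_le hdeg_top.ge), hdeg_top]
    have hdegpos : 0 < P.degree := by
      rw [hdegP]
      have : e 0 < e (Fin.last (k + 1)) := he (Fin.castSucc_lt_last 0 |>.trans_le' (Fin.zero_le _))
      exact_mod_cast (Nat.zero_le _).trans_lt this
    -- no zeros beyond the previous node
    have hno : ∀ z, r' (Fin.last k) < z → P.eval z ≠ 0 := by
      intro z hz
      rw [← hPeval]
      refine genVandermonde_det_ne_zero _ _ ?_ ?_ he.injective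
      · -- Fin.snoc r' z is injective: r' is strictly increasing and every r' i < z
        have hlt : ∀ i : Fin (k + 1), r' i < z := fun i => (hr'mono.monotone (Fin.le_last i)).trans_lt hz
        intro i j hij
        induction i using Fin.lastCases with
        | last =>
          induction j using Fin.lastCases with
          | last => rfl
          | cast j => rw [Fin.snoc_last, Fin.snoc_castSucc] at hij; exact absurd hij (hlt j).ne'
        | cast i =>
          induction j using Fin.lastCases with
          | last => rw [Fin.snoc_last, Fin.snoc_castSucc] at hij; exact absurd hij (hlt i).ne
          | cast j => rw [Fin.snoc_castSucc, Fin.snoc_castSucc] at hij; rw [hr'mono.injective hij]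
      · intro i
        refine Fin.lastCases ?_ (fun i => ?_) i
        · rw [Fin.snoc_last]; exact (h0.trans_le (hr'mono.monotone (Fin.zero_le _))).trans hz
        · rw [Fin.snoc_castSucc]; exact h0.trans_le (hr'mono.monotone (Fin.zero_le _))
    -- ray-sign at the actual last node
    have hlast : r' (Fin.last k) < r (Fin.last (k + 1)) := hr (Fin.castSucc_lt_last _)
    have := leadingCoeff_mul_eval_pos_of_no_roots_beyond P hdegpos _ hno _ hlast
    rw [hlc, ← hPeval, hsnoc] at this
    exact pos_of_mul_pos_right this htop.le

end Summit.ValiantsHypothesis.ValiantsHypothesis.Theorems.LacunarySymmetroidMatrixDescartes.Census
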